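import Literature.AlgebraicGeometry.AbelianVarieties.PicZeroOntoOfFiniteKTheta
import HarnessLib

/-!
# Čech cocycles of a proper flat family are `f`-power torsion when the fibres over `D(f)` are acyclic
# (Mumford, *Abelian Varieties*, §13 pp. 127–128: «the support of `R^i p_{2,*}(P)` is `{0̂}`», duality-free)

Topic `AlgebraicGeometry/Modules`; namespace `Literature.AlgebraicGeometry.Modules`.  THEOREMS ONLY (no definition, no named fact, no
instance, no notation, no `sorry`).  Cell `hodgecm-mathlib` (D-0151), DUAL-S road (A), brick **(B4) «SUPPORT AT 0̂»** of B-p04 (g40)'s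
duality-free «H1-DIM-ANY-CHAR CUT» (memo `MEMO-H1DIM-cut.v1.B-p04g40` §2), in GENERIC form (B-p08 (g34)): the input «each `r ∈ 𝔪` acts
locally nilpotently on every `Hʲ(K•)`» of the acyclicity lemma ★ (B1) `Algebra/Homology/AcyclicityLemmaRegularSequence`, produced from
fibrewise acyclicity off the closed point by ★ (CBC-1) `Modules/CechComplexFibreExactOfExact` (Mumford §5 Cor. 3, any presentation) and
affine base change to the basic open `D(f)`.

SETTING.  `g : X → B` proper and flat, `B` AFFINE of finite type over an algebraically closed field `k` (`f₀ : B → Spec k`), `𝓤` a finite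
cover of `X` by opens with affine finite intersections, `G` finite locally free on `X`, `C• := Č•(𝓤, G)` the ordered module Čech complex with
scalars `g♯ : Γ(B) → Γ(X)` (★ `Modules.cechComplex`), `f ∈ Γ(B, 𝒪_B)`.  HYPOTHESIS `hfib`: for every `k`-point `b` of `B` LYING IN `D(f)`
SOME cartesian square `IsPullback kX g' g b` has `Č•((kX⁻¹U_j)_j, kX^*G)` exact in every degree (e.g. the slice of an abelian scheme at a
point where the restricted line bundle is in `Pic⁰ ∖ 0`, ★ (D1) `AbelianVarieties/PicZeroCohomologyVanishing`).

* §1 `cechComplex_restrict_basicOpen_exactAt` — the Čech complex of `ι^*G` on the open piece `g⁻¹D(f) → D(f)` (cover `ι⁻¹𝓤`, affine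
  intersections since `(g⁻¹D(f)).ι` is an affine morphism) is exact in EVERY degree (★ CBC-1 `cechComplex_exactAt_of_forall_kPoint_isPullback`
  on `g ∣_ D(f)`, presentations lifted into the open piece by ★ `exists_lift_isPullback_morphismRestrict`, modules matched by Mathlib
  `pullbackComp`/`pullbackCongr` + ★ `sectionsSystemIsoOfIso`); `cechComplex_exact_baseChange_basicOpen` — equivalently `C• ⊗_{Γ(B)} Γ(D(f))`
  is exact in every degree (★ affine base change `exists_extendScalars_cechComplex_iso_of_isPullback` + ★ `exactAt_extendScalars_iff`).
* §2 **`exists_pow_smul_eq_d_of_forall_kPoint_basicOpen`** — COCYCLE FORM: for every cocycle `z ∈ Cʲ` there are `n` and `w ∈ Cʲ⁻¹` with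
  `fⁿ·z = d w` (`Γ(D(f)) = Γ(B)_f`, Mathlib `Γ_restrict_isLocalization`; denominators cleared with `IsLocalizedModule` on `m ↦ 1 ⊗ m`).
* §3 **`exists_pow_smul_eq_baseChange_d_of_forall_kPoint_basicOpen`** — THE SAME AFTER ANY BASE CHANGE: for every `Γ(B)`-algebra `R'` and
  every cocycle `z` of `R' ⊗_{Γ(B)} C•` (differentials `d ⊗ R'`) some `fⁿ·z` is a boundary — tested against `T = R'[1/f]`, a `Γ(D(f))`-algebra
  through `IsLocalization.Away.lift`, with ★ (E2) `cechComplex_exact_baseChange_of_exactAt` on the open piece, Mathlib `extendScalarsComp` and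
  `cancelBaseChange`.  With `R' := 𝒪_{Â,0̂}` (or `Γ(V)_𝔪`) this is VERBATIM the local-nilpotence hypothesis of ★ (B1)
  `exactAt_of_isWeaklyRegular_of_flat_of_locallyNilpotent` for the flat complex `C• ⊗ R'` and every `f ∈ 𝔪 ∩ Γ(V)`.
* §4 `isPullback_lift_id_toSpecOver_left` — the slice `(𝟙, y) : X → X ×_k Y` at a rational point `y` of ANY `k`-scheme `Y` presents the
  fibre of `p₂` at `y` (the presentation the H1-DIM head hands to `hfib` for `A × Â → Â`; ★ `isPullback_sliceSnd` is the case `Y = A`).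

HC_CM is proved only modulo the printed citations until rung 0 closes — nothing here bears on a summit statement; count-neutral ★ capital.

## References
* [MumfordAV1970] D. Mumford, *Abelian Varieties* (1970), §13, proof of the Theorem, pp. 127–128 («`R^ip_{2,*}(P)` has support `{0̂}`»);
  §5 Cor. 3 (p. 53); §8 (vii) (p. 76).
* [Hartshorne1977] R. Hartshorne, *Algebraic Geometry* (1977), III Thm. 12.11 (p. 290), III Prop. 9.3 (p. 255), II Ex. 2.16.
* [GortzWedhorn2023] U. Görtz, T. Wedhorn, *Algebraic Geometry II* (2023), Prop. 22.90 (p. 277), Def. 21.68 (p. 180), Lemma 21.172.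
* [AtiyahMacdonald1969] M. F. Atiyah, I. G. Macdonald (1969), Ch. 3 Prop. 3.3 and Prop. 3.5 (localization is exact; `S⁻¹A ⊗ M ≅ S⁻¹M`).
* [StacksProject] The Stacks Project, Tag 01JO (base change), Tag 02KH (affine base change of sections).
-/

noncomputable section

set_option backward.isDefEq.respectTransparency false

open CategoryTheory CategoryTheory.Limits AlgebraicGeometry TopologicalSpace Opposite TensorProduct

namespace Literature.AlgebraicGeometry.Modules

open Literature.Algebra.Homology Literature.AlgebraicGeometry.AbelianVarieties Literature.AlgebraicGeometry.HodgeTheory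
  Literature.AlgebraicGeometry.Motives Literature.AlgebraicGeometry.Morphisms

section Torsion

variable {k : Type} [Field k] [IsAlgClosed k] {X B : Scheme.{0}} (g : X ⟶ B) [IsAffine B] (f₀ : B ⟶ Spec (.of k))
  [LocallyOfFiniteType f₀] [IsProper g] [Flat g]
  {ι : Type} [LinearOrder ι] [Fintype ι] (U : ι → X.Opens) (hcov : ⨆ i, U i = ⊤)
  (hUa : ∀ s : Finset ι, s.Nonempty → IsAffineOpen (cechOpen U s)) (G : X.Modules) (hG : IsFiniteLocallyFree G) (f : Γ(B, ⊤))
  (hfib : ∀ b : Spec (.of k) ⟶ B, b ≫ f₀ = 𝟙 _ → b.base (IsLocalRing.closedPoint k) ∈ B.basicOpen f →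
    ∃ (F : Scheme.{0}) (kX : F ⟶ X) (g' : F ⟶ Spec (.of k)) (_ : IsPullback kX g' g b), ∀ i : ℤ,
      (cechComplex (fun j => kX ⁻¹ᵁ U j) ((Scheme.Modules.pullback kX).obj G) g'.appTop.hom).ExactAt i)

omit [IsAlgClosed k] [IsAffine B] [LocallyOfFiniteType f₀] [IsProper g] [Flat g] [LinearOrder ι] [Fintype ι] in
include hUa in
/-- The pulled-back cover `ι⁻¹𝓤` of the open piece `g⁻¹D(f)` has AFFINE finite intersections: `(g⁻¹D(f)).ι` is an affine morphism
(`g⁻¹D(f) = X_{g♯f}`, Mathlib `preimage_basicOpen_top` and the `IsAffineHom (X.basicOpen r).ι` instance). [cite: Hartshorne1977, II Ex. 2.16]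
[cite: GortzWedhorn2023, Def. 21.68 (p. 180)] -/
theorem isAffineOpen_cechOpen_preimage_basicOpen_ι (s : Finset ι) (hs : s.Nonempty) :
    IsAffineOpen (cechOpen (fun j => (g ⁻¹ᵁ B.basicOpen f).ι ⁻¹ᵁ U j) s) := by
  haveI : IsAffineHom (g ⁻¹ᵁ B.basicOpen f).ι := by
    rw [Scheme.preimage_basicOpen_top]; infer_instance
  rw [← preimage_cechOpen]
  exact (hUa s hs).preimage _

omit [IsAlgClosed k] [IsAffine B] [LocallyOfFiniteType f₀] [IsProper g] [Flat g] [LinearOrder ι] [Fintype ι] in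
include hcov in
/-- `ι⁻¹𝓤` covers the open piece. [cite: StacksProject, Tag 01JO] -/
theorem iSup_preimage_basicOpen_ι_preimage_eq_top : ⨆ j, (g ⁻¹ᵁ B.basicOpen f).ι ⁻¹ᵁ U j = ⊤ := by
  rw [← Scheme.Hom.preimage_iSup, hcov, Scheme.Hom.preimage_top]

include hcov hUa hG hfib in
/-- **§1 The Čech complex of the open piece `g⁻¹D(f) → D(f)` is exact in every degree** (★ CBC-1 any-presentation on `g ∣_ D(f)`: every
`k`-point of `D(f)` is a `k`-point of `B` in `D(f)`, its presentation from `hfib` lifts into the open piece by ★ `exists_lift_isPullback_morphismRestrict`,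
with the same opens `kX'⁻¹ι⁻¹U_j = kX⁻¹U_j` and isomorphic modules `kX'^*ι^*G ≅ kX^*G`). [cite: MumfordAV1970, §5 Cor. 3 (p. 53); §13 (pp. 127–128)]
[cite: Hartshorne1977, III Thm. 12.11 (p. 290)] -/
theorem cechComplex_restrict_basicOpen_exactAt (i : ℤ) :
    (cechComplex (fun j => (g ⁻¹ᵁ B.basicOpen f).ι ⁻¹ᵁ U j)
      ((Scheme.Modules.pullback (g ⁻¹ᵁ B.basicOpen f).ι).obj G) (g ∣_ B.basicOpen f).appTop.hom).ExactAt i := by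
  haveI : IsAffine (B.basicOpen f) := (isAffineOpen_top B).basicOpen f
  haveI : IsProper (g ∣_ B.basicOpen f) := IsZariskiLocalAtTarget.restrict (P := @IsProper) inferInstance _
  haveI : Flat (g ∣_ B.basicOpen f) := IsZariskiLocalAtTarget.restrict (P := @Flat) inferInstance _
  refine cechComplex_exactAt_of_forall_kPoint_isPullback (g ∣_ B.basicOpen f) (fun j => (g ⁻¹ᵁ B.basicOpen f).ι ⁻¹ᵁ U j)
    (isAffineOpen_cechOpen_preimage_basicOpen_ι g U hUa f) ((Scheme.Modules.pullback (g ⁻¹ᵁ B.basicOpen f).ι).obj G)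
    (hG.pullback _) ((B.basicOpen f).ι ≫ f₀) (iSup_preimage_basicOpen_ι_preimage_eq_top g U hcov f) i (fun b hb => ?_) i le_rfl
  -- the `k`-point `b ≫ ι` of `B` lies in `D(f)`
  have hb' : (b ≫ (B.basicOpen f).ι) ≫ f₀ = 𝟙 _ := by rw [Category.assoc, hb]
  have hmem : (b ≫ (B.basicOpen f).ι).base (IsLocalRing.closedPoint k) ∈ B.basicOpen f :=
    (b.base (IsLocalRing.closedPoint k)).2
  obtain ⟨F, kX, g', H, hH⟩ := hfib (b ≫ (B.basicOpen f).ι) hb' hmem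
  obtain ⟨kX', hk, H'⟩ := exists_lift_isPullback_morphismRestrict g (B.basicOpen f) b kX g' H
  refine ⟨F, kX', g', H', fun j _ => ?_⟩
  -- same opens, isomorphic modules
  have hop : (fun l => kX' ⁻¹ᵁ ((g ⁻¹ᵁ B.basicOpen f).ι ⁻¹ᵁ U l)) = fun l => kX ⁻¹ᵁ U l := by
    funext l
    rw [← Scheme.Hom.comp_preimage, hk]
  rw [hop]
  let e : (Scheme.Modules.pullback kX').obj ((Scheme.Modules.pullback (g ⁻¹ᵁ B.basicOpen f).ι).obj G) ≅
      (Scheme.Modules.pullback kX).obj G :=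
    (Scheme.Modules.pullbackComp kX' (g ⁻¹ᵁ B.basicOpen f).ι).app G ≪≫ (Scheme.Modules.pullbackCongr hk).app G
  exact (exactAt_iff_of_quasiIsoAt (sectionsSystemIsoOfIso (fun l => kX ⁻¹ᵁ U l) e g'.appTop.hom).hom j).2 (hH j)

include hcov hUa hG hfib in
/-- **`Č•(𝓤, G) ⊗_{Γ(B)} Γ(D(f))` is exact in every degree** (affine base change of the Čech complex along `D(f) ↪ B`, ★
`exists_extendScalars_cechComplex_iso_of_isPullback`, read through ★ `exactAt_extendScalars_iff`; the algebra structure is `(D(f).ι)♯`).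
[cite: GortzWedhorn2023, Prop. 22.90 (p. 277)] [cite: MumfordAV1970, §13 (pp. 127–128)] -/
theorem cechComplex_exact_baseChange_basicOpen (i : ℤ) :
    letI := (((B.basicOpen f).ι).appLE ⊤ ⊤ le_top).hom.toAlgebra
    Function.Exact (((cechComplex U G g.appTop.hom).d (i - 1) i).hom.baseChange Γ(B.basicOpen f, ⊤))
      (((cechComplex U G g.appTop.hom).d i (i + 1)).hom.baseChange Γ(B.basicOpen f, ⊤)) := by
  haveI : IsAffine (B.basicOpen f) := (isAffineOpen_top B).basicOpen f
  letI := (((B.basicOpen f).ι).appLE ⊤ ⊤ le_top).hom.toAlgebra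
  have hGa : IsAffineLocalizing G := by
    haveI := hG.isVectorBundle.1
    exact IsAffineLocalizing.of_isQuasicoherent G
  obtain ⟨Φ, -⟩ := exists_extendScalars_cechComplex_iso_of_isPullback (isPullback_morphismRestrict g (B.basicOpen f)).flip U hUa G hGa
  have h := (cechComplex_restrict_basicOpen_exactAt g f₀ U hcov hUa G hG f hfib i).of_iso Φ.symm
  rwa [exactAt_extendScalars_iff] at h

include hcov hUa hG hfib in
/-- **§2 COCYCLES ARE `f`-POWER TORSION MODULO COBOUNDARIES**: under `hfib` (fibres over `D(f)` acyclic), for every cocycle `z ∈ Čʲ(𝓤, G)` there are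
`n : ℕ` and `w ∈ Čʲ⁻¹` with `fⁿ • z = d w` — [MumfordAV1970] §13 «the support of `R^ip_{2,*}(P)` is `{0̂}`», read on the module Čech complex:
`Γ(D(f)) = Γ(B)[1/f]` (Mathlib `Γ_restrict_isLocalization`), `1 ⊗ z` is a boundary in the exact `Č ⊗ Γ(B)[1/f]` (§1), and denominators clear
(Mathlib `IsLocalization.tensorProduct_isLocalizedModule`, `IsLocalizedModule.surj`, `IsLocalizedModule.eq_zero_iff`).  Indices are kept free.
[cite: MumfordAV1970, §13 (proof of the Theorem, pp. 127–128)] [cite: AtiyahMacdonald1969, Ch. 3 Prop. 3.3 and Prop. 3.5] -/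
theorem exists_pow_smul_eq_d_of_forall_kPoint_basicOpen (i j l : ℤ) (hij : i + 1 = j) (hjl : j + 1 = l)
    (z : (cechComplex U G g.appTop.hom).X j) (hz : ((cechComplex U G g.appTop.hom).d j l).hom z = 0) :
    ∃ (n : ℕ) (w : (cechComplex U G g.appTop.hom).X i), f ^ n • z = ((cechComplex U G g.appTop.hom).d i j).hom w := by
  haveI : IsAffine (B.basicOpen f) := (isAffineOpen_top B).basicOpen f
  letI alg := (((B.basicOpen f).ι).appLE ⊤ ⊤ le_top).hom.toAlgebra
  -- `Γ(D(f))` is the localization of `Γ(B)` away from `f`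
  haveI : IsLocalization.Away f Γ(B.basicOpen f, ⊤) := by
    have halg : ((B.basicOpen f).ι.appLE ⊤ ⊤ le_top).hom = (B.presheaf.map (homOfLE le_top).op).hom := by
      rw [Scheme.Opens.ι_appLE]
    convert AlgebraicGeometry.Γ_restrict_isLocalization B f using 1
    exact congrArg RingHom.toAlgebra halg
  subst hij hjl
  have hex := cechComplex_exact_baseChange_basicOpen g f₀ U hcov hUa G hG f hfib (i + 1)
  rw [show i + 1 - 1 = i by omega] at hex
  -- `1 ⊗ z` is a cycle of `C ⊗ Γ(D(f))`, hence a boundary `d w'`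
  have hz' : (((cechComplex U G g.appTop.hom).d (i + 1) (i + 1 + 1)).hom.baseChange Γ(B.basicOpen f, ⊤))
      ((1 : Γ(B.basicOpen f, ⊤)) ⊗ₜ[Γ(B, ⊤)] z) = 0 := by
    rw [LinearMap.baseChange_tmul, hz, TensorProduct.tmul_zero]
  obtain ⟨w', hw'⟩ := (hex _).1 hz'
  -- `f ^ a • w' = 1 ⊗ w`
  obtain ⟨⟨w, ⟨_, a, rfl⟩⟩, hw⟩ := IsLocalizedModule.surj (Submonoid.powers f)
    (TensorProduct.mk Γ(B, ⊤) Γ(B.basicOpen f, ⊤) ((cechComplex U G g.appTop.hom).X i) 1) w'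
  -- `1 ⊗ (f ^ a • z - d w) = 0`
  simp only [Submonoid.smul_def] at hw
  have hcmp : (TensorProduct.mk Γ(B, ⊤) Γ(B.basicOpen f, ⊤) ((cechComplex U G g.appTop.hom).X (i + 1)) 1)
      (f ^ a • z - ((cechComplex U G g.appTop.hom).d i (i + 1)).hom w) = 0 := by
    rw [map_sub, sub_eq_zero, LinearMap.map_smul_of_tower, TensorProduct.mk_apply, TensorProduct.mk_apply, ← hw',
      ← LinearMap.map_smul_of_tower, hw, TensorProduct.mk_apply, LinearMap.baseChange_tmul]
  -- clear the denominator
  obtain ⟨s', hb⟩ := (IsLocalizedModule.eq_zero_iff (Submonoid.powers f)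
    (f := TensorProduct.mk Γ(B, ⊤) Γ(B.basicOpen f, ⊤) ((cechComplex U G g.appTop.hom).X (i + 1)) 1)).1 hcmp
  obtain ⟨b, hb'⟩ := (Submonoid.mem_powers_iff _ _).1 s'.2
  refine ⟨b + a, f ^ b • w, ?_⟩
  rw [Submonoid.smul_def, ← hb', smul_sub, sub_eq_zero, ← mul_smul, ← pow_add] at hb
  rw [hb, LinearMap.map_smul_of_tower]

include hcov hUa hG hfib in
set_option maxHeartbeats 400000 in
/-- **§3 THE SAME AFTER ANY BASE CHANGE**: for every `Γ(B)`-algebra `R'` and every cocycle `z` of `R' ⊗_{Γ(B)} Č•(𝓤, G)` (differentials `d ⊗ R'`)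
there are `n` and `w` with `fⁿ • z = (d ⊗ R') w`.  With `R' := 𝒪_{Â,0̂}` this is the local-nilpotence input of ★ (B1)
`exactAt_of_isWeaklyRegular_of_flat_of_locallyNilpotent` for `Č• ⊗ 𝒪_{Â,0̂}`.  Proof: `T := R'[1/f]` is a `Γ(D(f))`-algebra (Mathlib
`IsLocalization.Away.lift`); ★ (E2) `cechComplex_exact_baseChange_of_exactAt` on the open piece gives exactness of `Č_f ⊗_{Γ(D(f))} T`, i.e. (★ affine
base change, Mathlib `ModuleCat.extendScalarsComp`) of `Č ⊗_{Γ(B)} T`, i.e. (Mathlib `cancelBaseChange`) of `(R' ⊗ Č) ⊗_{R'} T`; denominators clear in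
`R'`. [cite: MumfordAV1970, §13 (proof of the Theorem, pp. 127–128)] [cite: AtiyahMacdonald1969, Ch. 3 Prop. 3.3 and Prop. 3.5]
[cite: GortzWedhorn2023, Lemma 21.172 and Prop. 22.90] -/
theorem exists_pow_smul_eq_baseChange_d_of_forall_kPoint_basicOpen (R' : Type) [CommRing R'] [Algebra Γ(B, ⊤) R']
    (i j l : ℤ) (hij : i + 1 = j) (hjl : j + 1 = l) (z : R' ⊗[Γ(B, ⊤)] (cechComplex U G g.appTop.hom).X j)
    (hz : ((cechComplex U G g.appTop.hom).d j l).hom.baseChange R' z = 0) :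
    ∃ (n : ℕ) (w : R' ⊗[Γ(B, ⊤)] (cechComplex U G g.appTop.hom).X i),
      algebraMap Γ(B, ⊤) R' f ^ n • z = ((cechComplex U G g.appTop.hom).d i j).hom.baseChange R' w := by
  haveI : IsAffine (B.basicOpen f) := (isAffineOpen_top B).basicOpen f
  haveI : IsProper (g ∣_ B.basicOpen f) := IsZariskiLocalAtTarget.restrict (P := @IsProper) inferInstance _
  haveI : Flat (g ∣_ B.basicOpen f) := IsZariskiLocalAtTarget.restrict (P := @Flat) inferInstance _
  haveI : IsLocallyNoetherian (B.basicOpen f : Scheme) :=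
    LocallyOfFiniteType.isLocallyNoetherian ((B.basicOpen f).ι ≫ f₀)
  subst hij hjl
  -- rings: `S = Γ(B)`, `S_f = Γ(D(f))`, `R'`, `T = R'[1/f]`
  set φ : Γ(B, ⊤) →+* Γ(B.basicOpen f, ⊤) := ((B.basicOpen f).ι.appLE ⊤ ⊤ le_top).hom with hφ
  letI algφ : Algebra Γ(B, ⊤) Γ(B.basicOpen f, ⊤) := φ.toAlgebra
  haveI : IsLocalization.Away f Γ(B.basicOpen f, ⊤) := by
    have halg : φ = (B.presheaf.map (homOfLE le_top).op).hom := by rw [hφ, Scheme.Opens.ι_appLE]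
    convert AlgebraicGeometry.Γ_restrict_isLocalization B f using 1
    exact congrArg RingHom.toAlgebra halg
  let T : Type := Localization.Away (algebraMap Γ(B, ⊤) R' f)
  have hunit : IsUnit (algebraMap Γ(B, ⊤) T f) := by
    rw [IsScalarTower.algebraMap_apply Γ(B, ⊤) R' T]
    exact IsLocalization.Away.algebraMap_isUnit (algebraMap Γ(B, ⊤) R' f)
  let ψ : Γ(B.basicOpen f, ⊤) →+* T := IsLocalization.Away.lift f hunit
  have hψφ : ψ.comp φ = algebraMap Γ(B, ⊤) T := IsLocalization.Away.lift_comp f hunit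
  letI algψ : Algebra Γ(B.basicOpen f, ⊤) T := ψ.toAlgebra
  -- (E2) on the restricted family, tested against the `Γ(D(f))`-algebra `T`
  have hT : ∀ i', Function.Exact
      (((cechComplex (fun j => (g ⁻¹ᵁ B.basicOpen f).ι ⁻¹ᵁ U j) ((Scheme.Modules.pullback (g ⁻¹ᵁ B.basicOpen f).ι).obj G)
        (g ∣_ B.basicOpen f).appTop.hom).d (i' - 1) i').hom.baseChange T)
      (((cechComplex (fun j => (g ⁻¹ᵁ B.basicOpen f).ι ⁻¹ᵁ U j) ((Scheme.Modules.pullback (g ⁻¹ᵁ B.basicOpen f).ι).obj G)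
        (g ∣_ B.basicOpen f).appTop.hom).d i' (i' + 1)).hom.baseChange T) := fun i' =>
    cechComplex_exact_baseChange_of_exactAt (g ∣_ B.basicOpen f) (fun j => (g ⁻¹ᵁ B.basicOpen f).ι ⁻¹ᵁ U j)
      (iSup_preimage_basicOpen_ι_preimage_eq_top g U hcov f) (isAffineOpen_cechOpen_preimage_basicOpen_ι g U hUa f)
      ((Scheme.Modules.pullback (g ⁻¹ᵁ B.basicOpen f).ι).obj G) (hG.pullback _) i'
      (fun i'' _ => cechComplex_restrict_basicOpen_exactAt g f₀ U hcov hUa G hG f hfib i'') T i' le_rfl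
  -- move to `C ⊗_S T` through the affine base-change isomorphism and `extendScalars ψ ∘ extendScalars φ = extendScalars (ψ ∘ φ)`
  have hGa : IsAffineLocalizing G := by
    haveI := hG.isVectorBundle.1
    exact IsAffineLocalizing.of_isQuasicoherent G
  obtain ⟨Φ, -⟩ := exists_extendScalars_cechComplex_iso_of_isPullback (isPullback_morphismRestrict g (B.basicOpen f)).flip U hUa G hGa
  haveI := additive_extendScalars φ
  haveI := additive_extendScalars ψ
  haveI := additive_extendScalars (algebraMap Γ(B, ⊤) T)
  have hCT : Function.Exact (((cechComplex U G g.appTop.hom).d i (i + 1)).hom.baseChange T)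
      (((cechComplex U G g.appTop.hom).d (i + 1) (i + 1 + 1)).hom.baseChange T) := by
    have h1 : (((ModuleCat.extendScalars ψ).mapHomologicalComplex (ComplexShape.up ℤ)).obj
        (cechComplex (fun j => (g ⁻¹ᵁ B.basicOpen f).ι ⁻¹ᵁ U j) ((Scheme.Modules.pullback (g ⁻¹ᵁ B.basicOpen f).ι).obj G)
        (g ∣_ B.basicOpen f).appTop.hom)).ExactAt (i + 1) := by
      rw [exactAt_extendScalars_iff]
      exact hT (i + 1)
    have ecomp : ModuleCat.extendScalars φ ⋙ ModuleCat.extendScalars ψ ≅ ModuleCat.extendScalars (algebraMap Γ(B, ⊤) T) :=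
      (ModuleCat.extendScalarsComp φ ψ).symm ≪≫ eqToIso (congrArg ModuleCat.extendScalars hψφ)
    have e : ((ModuleCat.extendScalars ψ).mapHomologicalComplex (ComplexShape.up ℤ)).obj
        (((ModuleCat.extendScalars φ).mapHomologicalComplex (ComplexShape.up ℤ)).obj (cechComplex U G g.appTop.hom)) ≅
        ((ModuleCat.extendScalars (algebraMap Γ(B, ⊤) T)).mapHomologicalComplex (ComplexShape.up ℤ)).obj (cechComplex U G g.appTop.hom) :=
      (Functor.mapHomologicalComplexCompIso ecomp (ComplexShape.up ℤ)).app _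
    have h2 := (h1.of_iso (((ModuleCat.extendScalars ψ).mapHomologicalComplex (ComplexShape.up ℤ)).mapIso Φ.symm)).of_iso e
    rw [exactAt_extendScalars_iff, show i + 1 - 1 = i by omega] at h2
    -- the two `Γ(B)`-algebra structures on `T` agree
    have hinst : (algebraMap Γ(B, ⊤) T).toAlgebra = (inferInstance : Algebra Γ(B, ⊤) T) :=
      Algebra.algebra_ext _ _ fun r => rfl
    rw [hinst] at h2
    exact h2
  -- move to `T ⊗_{R'} (R' ⊗_S C)` along `cancelBaseChange`
  have hlad : ∀ (a b : ℤ),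
      ((((cechComplex U G g.appTop.hom).d a b).hom.baseChange R').baseChange T) ∘ₗ
          (TensorProduct.AlgebraTensorModule.cancelBaseChange Γ(B, ⊤) R' T T ((cechComplex U G g.appTop.hom).X a)).symm.toLinearMap =
        (TensorProduct.AlgebraTensorModule.cancelBaseChange Γ(B, ⊤) R' T T ((cechComplex U G g.appTop.hom).X b)).symm.toLinearMap ∘ₗ
          (((cechComplex U G g.appTop.hom).d a b).hom.baseChange T) := fun a b => by
    have hs : ∀ (M : Type) [AddCommGroup M] [Module Γ(B, ⊤) M] (t : T) (m : M),
        (TensorProduct.AlgebraTensorModule.cancelBaseChange Γ(B, ⊤) R' T T M).symm (t ⊗ₜ[Γ(B, ⊤)] m) =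
          t ⊗ₜ[R'] ((1 : R') ⊗ₜ[Γ(B, ⊤)] m) := fun M _ _ t m => by
      rw [LinearEquiv.symm_apply_eq, TensorProduct.AlgebraTensorModule.cancelBaseChange_tmul, one_smul]
    apply TensorProduct.AlgebraTensorModule.ext
    intro t x
    simp only [LinearMap.comp_apply, LinearEquiv.coe_toLinearMap, LinearMap.baseChange_tmul, hs]
  have hRT : Function.Exact ((((cechComplex U G g.appTop.hom).d i (i + 1)).hom.baseChange R').baseChange T)
      ((((cechComplex U G g.appTop.hom).d (i + 1) (i + 1 + 1)).hom.baseChange R').baseChange T) :=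
    (Function.Exact.iff_of_ladder_linearEquiv
      (e₁ := (TensorProduct.AlgebraTensorModule.cancelBaseChange Γ(B, ⊤) R' T T ((cechComplex U G g.appTop.hom).X i)).symm)
      (e₂ := (TensorProduct.AlgebraTensorModule.cancelBaseChange Γ(B, ⊤) R' T T ((cechComplex U G g.appTop.hom).X (i + 1))).symm)
      (e₃ := (TensorProduct.AlgebraTensorModule.cancelBaseChange Γ(B, ⊤) R' T T
        ((cechComplex U G g.appTop.hom).X (i + 1 + 1))).symm)
      (hlad i (i + 1)) (hlad (i + 1) (i + 1 + 1))).2 hCT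
  -- clear denominators in `R'`
  have hz' : ((((cechComplex U G g.appTop.hom).d (i + 1) (i + 1 + 1)).hom.baseChange R').baseChange T) ((1 : T) ⊗ₜ[R'] z) = 0 := by
    rw [LinearMap.baseChange_tmul, hz, TensorProduct.tmul_zero]
  obtain ⟨w', hw'⟩ := (hRT _).1 hz'
  obtain ⟨⟨w, s⟩, hw⟩ := IsLocalizedModule.surj (Submonoid.powers (algebraMap Γ(B, ⊤) R' f))
    (TensorProduct.mk R' T (R' ⊗[Γ(B, ⊤)] (cechComplex U G g.appTop.hom).X i) 1) w'
  obtain ⟨a, ha⟩ := (Submonoid.mem_powers_iff _ _).1 s.2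
  rw [Submonoid.smul_def, ← ha] at hw
  dsimp only at hw
  have hcmp : (TensorProduct.mk R' T (R' ⊗[Γ(B, ⊤)] (cechComplex U G g.appTop.hom).X (i + 1)) 1)
      (algebraMap Γ(B, ⊤) R' f ^ a • z - ((cechComplex U G g.appTop.hom).d i (i + 1)).hom.baseChange R' w) = 0 := by
    rw [map_sub, sub_eq_zero, map_smul, TensorProduct.mk_apply, TensorProduct.mk_apply, ← hw',
      ← algebraMap_smul T (algebraMap Γ(B, ⊤) R' f ^ a), ← map_smul, algebraMap_smul, hw, TensorProduct.mk_apply,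
      LinearMap.baseChange_tmul]
  obtain ⟨s', hb⟩ := (IsLocalizedModule.eq_zero_iff (Submonoid.powers (algebraMap Γ(B, ⊤) R' f))
    (f := TensorProduct.mk R' T (R' ⊗[Γ(B, ⊤)] (cechComplex U G g.appTop.hom).X (i + 1)) 1)).1 hcmp
  obtain ⟨b, hb'⟩ := (Submonoid.mem_powers_iff _ _).1 s'.2
  refine ⟨b + a, algebraMap Γ(B, ⊤) R' f ^ b • w, ?_⟩
  rw [Submonoid.smul_def, ← hb', smul_sub, sub_eq_zero, ← mul_smul, ← pow_add] at hb
  rw [hb, map_smul]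

end Torsion


/-! ## §4 The slice of `X ×_k Y` at a rational point of `Y` presents the fibre of the second projection -/

section Slice

open MonoidalCategory CartesianMonoidalCategory

variable {k : Type} [Field k] (X Y : SchemeOver k)

/-- **The slice `(𝟙, y) : X → X ×_k Y` at a rational point `y ∈ Y(k)` is CARTESIAN over `y : Spec k → Y`** (`X ≅ X ×_k {y}`): the (S2)
presentation of the fibre of `p₂ : X ×_k Y → Y` at `y` — for an abelian variety `A` and the base `Y = Â` of a Poincaré family this is the presentation
handed to `hfib` above, and ★ `isPullback_sliceSnd` is the case `Y = A`.  (Paste Mathlib's product square with the square of isomorphisms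
`(𝟙, y) ≫ p₁ = 𝟙`, `y ≫ (Y → Spec k) = 𝟙`.) [cite: StacksProject, Tag 01JO] [cite: Hartshorne1977, II Thm. 3.3 (p. 89)] -/
theorem isPullback_lift_id_toSpecOver_left (y : AlgPoints Y k) :
    IsPullback (lift (𝟙 X) (toSpecOver X ≫ y)).left X.hom (snd X Y).left y.toSpecHom := by
  have hR : IsPullback (fst X Y).left (snd X Y).left X.hom Y.hom := IsPullback.of_hasPullback X.hom Y.hom
  have h1 : (lift (𝟙 X) (toSpecOver X ≫ y)).left ≫ (fst X Y).left = 𝟙 X.left := by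
    rw [← Over.comp_left, lift_fst]
    rfl
  have h2 : y.toSpecHom ≫ Y.hom = 𝟙 (Spec (.of k)) := by
    rw [AlgPoints.toSpecHom, Over.w y]
    change Spec.map (CommRingCat.ofHom (algebraMap k k)) = _
    rw [Algebra.algebraMap_self, CommRingCat.ofHom_id, Spec.map_id]
  refine IsPullback.of_right ?_ ?_ hR
  · haveI : IsIso ((lift (𝟙 X) (toSpecOver X ≫ y)).left ≫ (fst X Y).left) := h1 ▸ inferInstance
    haveI : IsIso (y.toSpecHom ≫ Y.hom) := h2 ▸ inferInstance
    exact IsPullback.of_horiz_isIso ⟨by rw [h1, h2, Category.id_comp, Category.comp_id]⟩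
  · rw [← Over.comp_left, lift_snd, Over.comp_left, toSpecOver_left]

end Slice

end Literature.AlgebraicGeometry.Modules

end
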